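import Literature.MathematicalPhysics.QuantumLattice.GroundStateReflectionPositivity
import Literature.MathematicalPhysics.QuantumLattice.HeisenbergOrderDLSProofs
import Literature.MathematicalPhysics.QuantumLattice.HeisenbergGroundStateSymmetry
import Literature.MathematicalPhysics.QuantumLattice.SpinChainsAkltCorrelationProofs
import Literature.MathematicalPhysics.QuantumManyBody.StateRelaxationDuality
import Literature.Probability.LatticeModels.TorusBipartite
import HarnessLib

/-!
# Ground-state reflection positivity of the Heisenberg antiferromagnet in word form

Topic `MathematicalPhysics/QuantumLattice`, families `heisenberg` / `bootstrap`.  Let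
`H = J Σ_{⟨xy⟩} 𝐒_x·𝐒_y`, `J > 0`, on the even torus `(ℤ/Lℤ)^d` (any spin `n/2`), let `θ` be the
reflection between sites in the plane pair `xⱼ = a + ½`, `xⱼ = a + ½ + L/2`
(`Torus.reflectBetweenSites j a`) and `Λ_L = torusLeftHalf L j a` the left half.  A WORD is a list of
letters `(x, ℓ)`, `x ∈ Λ_L`, `ℓ ∈ {+, −, z}` (`SpinLetter`), read as the operator product
`m = S^{ℓ₁}_{x₁} ⋯ S^{ℓ_r}_{x_r}` (`rpWord`); its REFLECTED CONJUGATE is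
`Θ̄m = S^{ℓ̄₁}_{θx₁} ⋯ S^{ℓ̄_r}_{θx_r}` with `+̄ = −`, `−̄ = +`, `z̄ = z` (`rpReflWord`; same order of
factors).  The ground state `ω` of `H` is unique (Lieb–Mattis on the balanced bipartite torus,
`heisenbergTorus_hasUniqueGroundState_of_two_dvd`) and

  `R_ab = (−1)^{|m_b|} ω(m_a · Θ̄m_b)`  is positive semidefinite

for every finite family of words (`heisenbergTorus_rpGram_posSemidef` for a unit ground-state
vector, `heisenbergTorus_groundStateFunctional_rpGram_posSemidef` for the ground-state functional).
This is Dyson–Lieb–Simon's ground-state (`β → ∞`) reflection positivity [DLS1978, Theorem 4.2] in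
the spin-operator form of Kennedy–Lieb–Shastry [KLS1988JSP, eqs. (15)–(25)]: the sign `(−1)^{|m|}`
and the conjugation `S⁺ ↔ S⁻` are what the unitary sublattice rotation by `π` about the `2`-axis
leaves behind; the statements mention neither the rotation nor sublattice parities.

As a CERTIFICATE ROW (shape of `StateRelaxation.groundEnergy_ge_of_certificate`, Han 2020
eq. (2)–(3)): for `G ⪰ 0` the block `rpForm L j a n G m = Σ_ab G_ab (−1)^{|m_b|} m_a Θ̄m_b` has
`ω(rpForm) = Σ_ab G_ab R_ab ≥ 0` (`heisenbergTorus_groundStateFunctional_rpForm_nonneg`), so an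
identity `H − c·1 = Σ Λᵢⱼ Oᵢᴴ Oⱼ + Σ (H Xₖ − Xₖ H) + Σ (Uₗ Yₗ Uₗᴴ − Yₗ) + rpForm G m` with `Λ ⪰ 0`,
unitaries `Uₗ` commuting with `H` and `G ⪰ 0` certifies `c ≤ E₀(H)`
(`heisenbergTorus_groundEnergy_ge_of_certificate_rp`; with a residual `r`, `−ε ≤ Re ω(r)`, the bound
is `c − ε ≤ E₀(H)`, `heisenbergTorus_groundEnergy_ge_of_certificate_rp_residual`).  Valid for this model class only
(reflection-symmetric antiferromagnetic couplings, even torus, non-degenerate ground state).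

Proof.  After the sublattice rotation `W` (`exists_sublatticeRotation`: `W H Wᴴ = J·X`,
`X = Σ (−S¹S¹ + S²S² − S³S³)`) the rotated Hamiltonian has the Kronecker form
`A ⊗ 1 + 1 ⊗ A − Σᵢ Mᵢ ⊗ Mᵢ` with `A` real symmetric and `Mᵢ` real (`dlsField_eq_submatrix`,
`dlsLeft_transpose_eq`, `dlsCrossOp_transpose_eq`), so its unique ground state — transported along
`W` and the half-torus splitting — is reflection positive in Gram form
(`Matrix.groundState_reflectionPositive`): `[⟨X_j ⊗ X̄_i⟩]_{ij} ⪰ 0` for the real word operators of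
the left half.  Pulling back letter by letter (`Wᴴ S^ℓ_y W = S^ℓ_y` on the even sublattice,
`= −S^{ℓ̄}_y` on the odd one; `y` and `θy` have opposite parity) identifies that Gram matrix with
`D R D`, `D` a diagonal sign matrix, whence `R ⪰ 0`.  The private section `GroundStateRP` holds this
bookkeeping (transport of ground spaces along `W H Wᴴ = c·K|_e`, the Schur pairing of two positive
semidefinite matrices, conjugation of products, sublattice parity).  Everything is proved; no named
facts.  Related in-tree: the one-letter, easy-plane XXZ (`d = 2`, spin ½) instance
`Summit.HubbardSuperconductivity.HubbardSuperconductivity.Theorems.LevyLogBootstrap.transverseGram_posSemidef_of_kroneckerForm`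
(summit tree; this file is the isotropic antiferromagnet, all spins and dimensions, arbitrary
words).  (Written for the pub-hubbard certificate ladder — ladder R1–R4 with certified numbers; no
claim on H/H₀; no certificate using the `rp` block exists yet.)
-/

noncomputable section

open Matrix Literature.Probability.LatticeModels
open Literature.MathematicalPhysics.QuantumManyBody.StateRelaxation
open scoped Kronecker ComplexOrder MatrixOrder

namespace Literature.MathematicalPhysics.QuantumLattice

/-! ### Letters and words -/

/-- The letters of the word alphabet `S⁺`, `S⁻`, `Sᶻ` of the algebra `𝔄₊` generated by the spin
operators of one half of the torus. [cite: DLS1978, §4] -/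
inductive SpinLetter
  | plus
  | minus
  | zee
  deriving DecidableEq

namespace SpinLetter

/-- The single-site matrix of a letter (spin `n/2`): `S⁺ = spinRaise`, `S⁻ = spinLower`,
`Sᶻ = spinZ`. [folklore] -/
def mat (n : ℕ) : SpinLetter → Matrix (Fin (n + 1)) (Fin (n + 1)) ℂ
  | plus => spinRaise n
  | minus => spinLower n
  | zee => SpinOperators.spinZ n

/-- The conjugate letter `+̄ = −`, `−̄ = +`, `z̄ = z` (the entrywise complex conjugate `Ō` of a real
basis operator after the sublattice rotation). [cite: KLS1988JSP, eq. (22)] -/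
def bar : SpinLetter → SpinLetter
  | plus => minus
  | minus => plus
  | zee => zee

/-- Conjugation is an involution. [folklore] -/
@[simp] private theorem bar_bar (l : SpinLetter) : l.bar.bar = l := by cases l <;> rfl

/-- Every letter is a real matrix in the `Sᶻ` basis. [folklore] -/
private theorem mat_transpose_eq (n : ℕ) (l : SpinLetter) : (l.mat n)ᵀ = (l.mat n)ᴴ := by
  cases l
  · exact transpose_eq_conjTranspose_of_star (star_spinRaise_apply n)
  · exact transpose_eq_conjTranspose_of_star (star_spinLower_apply n)
  · exact spinZ_transpose_eq n

/-- The letter twisted by a sublattice parity `t ∈ ℤ/2`: itself on the even sublattice, its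
conjugate on the odd one. [folklore] -/
private def twist (t : ZMod 2) (l : SpinLetter) : SpinLetter := if t = 0 then l else l.bar

/-- Twisting twice by the same parity is the identity. [folklore] -/
private theorem twist_twist (t : ZMod 2) (l : SpinLetter) : twist t (twist t l) = l := by
  unfold twist; split_ifs <;> simp

/-- Twisting by both parities conjugates. [folklore] -/
private theorem twist_add_one_twist (t : ZMod 2) (l : SpinLetter) : twist (t + 1) (twist t l) = l.bar := by
  have h01 : ∀ s : ZMod 2, s = 0 ∨ s = 1 := by decide
  have h11 : (1 : ZMod 2) + 1 = 0 := by decide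
  unfold twist
  rcases h01 t with h | h <;> subst h <;> simp [h11]

end SpinLetter

section Words

variable {d : ℕ} (L : ℕ) [NeZero L] (j : Fin d) (a : ZMod L) (n : ℕ)

/-- The word operator `m = S^{ℓ₁}_{x₁} ⋯ S^{ℓ_r}_{x_r}` of a word in the left half
`torusLeftHalf L j a` (an element of DLS's algebra `𝔄₊`). [cite: DLS1978, §4] -/
def rpWord (w : List (torusLeftHalf L j a × SpinLetter)) : Op (TorusSite d L) (n + 1) :=
  (w.map fun q => onSite (q.1 : TorusSite d L) (q.2.mat n)).prod

/-- The reflected conjugate word `Θ̄m = S^{ℓ̄₁}_{θx₁} ⋯ S^{ℓ̄_r}_{θx_r}` (same order of factors,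
reflected sites `θ = Torus.reflectBetweenSites j a`, conjugate letters): KLS's `θ(Ō)`.
[cite: KLS1988JSP, eq. (22)] -/
def rpReflWord (w : List (torusLeftHalf L j a × SpinLetter)) : Op (TorusSite d L) (n + 1) :=
  (w.map fun q => onSite (Torus.reflectBetweenSites j a (q.1 : TorusSite d L)) (q.2.bar.mat n)).prod

/-- The reflection-positivity block of a ground-state certificate:
`Σ_ab G_ab (−1)^{|m_b|} m_a Θ̄m_b` (nonnegative in the ground state for `G ⪰ 0`,
`heisenbergTorus_groundStateFunctional_rpForm_nonneg`). [cite: DLS1978, Theorem 4.2] -/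
def rpForm {κ : Type*} [Fintype κ] (G : Matrix κ κ ℂ)
    (w : κ → List (torusLeftHalf L j a × SpinLetter)) : Op (TorusSite d L) (n + 1) :=
  ∑ a', ∑ b, G a' b • ((-1 : ℂ) ^ (w b).length • (rpWord L j a n (w a') * rpReflWord L j a n (w b)))

end Words

/-! ### Bookkeeping (private): transport of ground states, the Schur pairing, conjugation of
products, sublattice parity, the letter rule of the sublattice rotation, rotated-frame words -/

namespace GroundStateRP

/-! ### Transport of ground states along a unitary conjugation composed with a reindexing -/

section Transport

variable {m p : Type*} [Fintype m] [DecidableEq m] [Fintype p] [DecidableEq p]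

/-- `⟨W v, W v⟩ = ⟨v, v⟩` for `Wᴴ W = 1`. [folklore] -/
private theorem star_mulVec_dotProduct_mulVec_self {W : Matrix m m ℂ} (hW' : Wᴴ * W = 1) (v : m → ℂ) :
    star (W *ᵥ v) ⬝ᵥ (W *ᵥ v) = star v ⬝ᵥ v := by
  rw [star_mulVec, ← dotProduct_mulVec, mulVec_mulVec, hW', one_mulVec]

omit [DecidableEq m] [DecidableEq p] in
/-- Reindexing a vector state along an equivalence: `⟨u∘e⁻¹, N (u∘e⁻¹)⟩ = ⟨u, N|_e u⟩`. [folklore] -/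
private theorem star_comp_dotProduct_mulVec_comp (N : Matrix p p ℂ) (e : m ≃ p) (u : m → ℂ) :
    star (u ∘ e.symm) ⬝ᵥ (N *ᵥ (u ∘ e.symm)) = star u ⬝ᵥ ((N.submatrix e e) *ᵥ u) := by
  rw [submatrix_mulVec_equiv]
  simp only [dotProduct, Function.comp_apply, Pi.star_apply]
  exact (Fintype.sum_equiv e _ _ fun σ => by simp only [Equiv.symm_apply_apply]).symm

omit [DecidableEq m] [DecidableEq p] in
/-- `⟨u∘e⁻¹, u∘e⁻¹⟩ = ⟨u, u⟩`. [folklore] -/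
private theorem star_comp_dotProduct_comp_equiv (e : m ≃ p) (u : m → ℂ) :
    star (u ∘ e.symm) ⬝ᵥ (u ∘ e.symm) = star u ⬝ᵥ u := by
  simp only [dotProduct, Function.comp_apply, Pi.star_apply]
  exact (Fintype.sum_equiv e _ _ fun σ => by simp only [Equiv.symm_apply_apply]).symm

variable {H W : Matrix m m ℂ} {K : Matrix p p ℂ} {e : m ≃ p} {c : ℝ}

/-- Ground energies along `W H Wᴴ = c · K|_e`, `W` unitary, `c > 0`: `E₀(H) = c E₀(K)`. [folklore] -/
private theorem groundEnergy_eq_of_conj_submatrix [Nonempty m] (hK : K.IsHermitian) (hW : W * Wᴴ = 1)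
    (hc : 0 < c) (hconj : W * H * Wᴴ = (c : ℂ) • K.submatrix e e) :
    H.groundEnergy = c * K.groundEnergy := by
  have hU : W ∈ Matrix.unitaryGroup m ℂ := Matrix.mem_unitaryGroup_iff.2 (by
    rw [star_eq_conjTranspose]; exact hW)
  rw [← Matrix.groundEnergy_unitary_conj (A := H) hU, hconj,
    Matrix.groundEnergy_smul_of_pos (hK.submatrix e) hc, Matrix.groundEnergy_submatrix_equiv hK e]

/-- Ground spaces along `W H Wᴴ = c · K|_e`: `v` is a ground state of `H` iff `(W v) ∘ e⁻¹` is a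
ground state of `K`. [folklore] -/
private theorem mem_groundSpace_iff_of_conj_submatrix [Nonempty m] (hK : K.IsHermitian) (hW : W * Wᴴ = 1)
    (hW' : Wᴴ * W = 1) (hc : 0 < c) (hconj : W * H * Wᴴ = (c : ℂ) • K.submatrix e e) (v : m → ℂ) :
    v ∈ H.groundSpace ↔ (W *ᵥ v) ∘ e.symm ∈ K.groundSpace := by
  have hE := groundEnergy_eq_of_conj_submatrix hK hW hc hconj
  have hc0 : (c : ℂ) ≠ 0 := by exact_mod_cast hc.ne'
  -- `K ((W v)∘e⁻¹) = (K|_e (W v)) ∘ e⁻¹`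
  have h4 : K *ᵥ ((W *ᵥ v) ∘ e.symm) = (K.submatrix e e *ᵥ (W *ᵥ v)) ∘ e.symm := by
    rw [submatrix_mulVec_equiv]; ext q; simp
  -- `(W H Wᴴ)(W v) = W (H v)`
  have h5 : (W * H * Wᴴ) *ᵥ (W *ᵥ v) = W *ᵥ (H *ᵥ v) := by
    rw [mulVec_mulVec, Matrix.mul_assoc (W * H), hW', Matrix.mul_one, ← mulVec_mulVec]
  rw [Matrix.mem_groundSpace_iff, Matrix.mem_groundSpace_iff, h4]
  constructor
  · intro hv
    have h3 : ((c : ℂ) • K.submatrix e e) *ᵥ (W *ᵥ v) = (H.groundEnergy : ℂ) • (W *ᵥ v) := by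
      rw [← hconj, h5, hv, mulVec_smul]
    rw [smul_mulVec, hE, Complex.ofReal_mul, ← smul_smul] at h3
    have h2 : K.submatrix e e *ᵥ (W *ᵥ v) = (K.groundEnergy : ℂ) • (W *ᵥ v) :=
      smul_right_injective _ hc0 h3
    rw [h2]; ext q; simp
  · intro hv
    -- `K|_e (W v) = E₀(K) (W v)`
    have h2 : K.submatrix e e *ᵥ (W *ᵥ v) = (K.groundEnergy : ℂ) • (W *ᵥ v) := by
      have := congrArg (fun f => f ∘ e) hv
      simp only [Function.comp_assoc, Equiv.symm_comp_self, Function.comp_id] at this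
      rw [this]; ext σ; simp
    have h3 : W *ᵥ (H *ᵥ v) = (H.groundEnergy : ℂ) • (W *ᵥ v) := by
      rw [← h5, hconj, smul_mulVec, h2, smul_smul, ← Complex.ofReal_mul, ← hE]
    have := congrArg (fun u => Wᴴ *ᵥ u) h3
    simp only [mulVec_mulVec, hW', one_mulVec, mulVec_smul] at this
    rw [← Matrix.mul_assoc, hW', Matrix.one_mul] at this
    exact this

/-- The map `v ↦ (W v) ∘ e⁻¹`, linear. [folklore] -/
private def conjReindexMap (W : Matrix m m ℂ) (e : m ≃ p) : (m → ℂ) →ₗ[ℂ] (p → ℂ) where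
  toFun v := (W *ᵥ v) ∘ e.symm
  map_add' v v' := by ext q; simp [mulVec_add]
  map_smul' c v := by ext q; simp [mulVec_smul]

omit [DecidableEq m] [Fintype p] [DecidableEq p] in
/-- Unfolding `conjReindexMap`. [folklore] -/
@[simp] private theorem conjReindexMap_apply (W : Matrix m m ℂ) (e : m ≃ p) (v : m → ℂ) :
    conjReindexMap W e v = (W *ᵥ v) ∘ e.symm := rfl

/-- Uniqueness of the ground state is transported along `W H Wᴴ = c · K|_e`. [folklore] -/
private theorem hasUniqueGroundState_of_conj_submatrix [Nonempty m] (hK : K.IsHermitian) (hW : W * Wᴴ = 1)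
    (hW' : Wᴴ * W = 1) (hc : 0 < c) (hconj : W * H * Wᴴ = (c : ℂ) • K.submatrix e e)
    (hu : H.HasUniqueGroundState) : K.HasUniqueGroundState := by
  have hiff := mem_groundSpace_iff_of_conj_submatrix hK hW hW' hc hconj
  set Φ := conjReindexMap W e with hΦ
  have hinj : Function.Injective Φ := by
    intro v v' hvv
    have h1 : W *ᵥ v = W *ᵥ v' := by
      have := congrArg (fun f => f ∘ e) hvv
      simpa [hΦ, Function.comp_assoc] using this
    have := congrArg (fun u => Wᴴ *ᵥ u) h1
    simpa [mulVec_mulVec, hW'] using this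
  have hmap : Submodule.map Φ H.groundSpace = K.groundSpace := by
    ext u
    rw [Submodule.mem_map]
    constructor
    · rintro ⟨v, hv, rfl⟩
      exact (hiff v).1 hv
    · intro hu'
      refine ⟨Wᴴ *ᵥ (u ∘ e), ?_, ?_⟩
      · rw [hiff]
        have : (W *ᵥ (Wᴴ *ᵥ (u ∘ ⇑e))) ∘ ⇑e.symm = u := by
          rw [mulVec_mulVec, hW, one_mulVec]; ext q; simp
        rw [this]; exact hu'
      · show (W *ᵥ (Wᴴ *ᵥ (u ∘ ⇑e))) ∘ ⇑e.symm = u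
        rw [mulVec_mulVec, hW, one_mulVec]; ext q; simp
  unfold Matrix.HasUniqueGroundState Matrix.groundStateDegeneracy at hu ⊢
  rw [← hmap, ← (Submodule.equivMapOfInjective Φ hinj H.groundSpace).finrank_eq, hu]

end Transport

/-! ### The Schur pairing of two positive semidefinite matrices -/

section Pairing

variable {κ : Type*} [Fintype κ] [DecidableEq κ]

/-- `Σ_ab G_ab F_ab ≥ 0` for `G, F ⪰ 0` (`= tr(G Fᵀ)`, Schur): with `G = B⋆B`,
`Σ_ab G_ab F_ab = Σ_k ⟨B_k, F B_k⟩`. [folklore] -/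
private theorem sum_sum_mul_nonneg_of_posSemidef {G F : Matrix κ κ ℂ} (hG : G.PosSemidef)
    (hF : F.PosSemidef) : 0 ≤ ∑ a, ∑ b, G a b * F a b := by
  obtain ⟨B, hB⟩ := CStarAlgebra.nonneg_iff_eq_star_mul_self.mp hG.nonneg
  have hprod : ∀ a b : κ, G a b = ∑ k, star (B k a) * B k b := by
    intro a b
    rw [hB, Matrix.star_eq_conjTranspose, Matrix.mul_apply]
    exact Finset.sum_congr rfl fun k _ => by rw [conjTranspose_apply]
  have key : ∑ a, ∑ b, G a b * F a b = ∑ k, star (B k) ⬝ᵥ (F *ᵥ B k) := by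
    simp only [dotProduct, mulVec, Pi.star_apply, Finset.mul_sum, hprod, Finset.sum_mul]
    calc ∑ a, ∑ b, ∑ k, star (B k a) * B k b * F a b
        = ∑ a, ∑ k, ∑ b, star (B k a) * B k b * F a b :=
          Finset.sum_congr rfl fun a _ => Finset.sum_comm
      _ = ∑ k, ∑ a, ∑ b, star (B k a) * B k b * F a b := Finset.sum_comm
      _ = ∑ k, ∑ a, ∑ b, star (B k a) * (F a b * B k b) :=
          Finset.sum_congr rfl fun k _ => Finset.sum_congr rfl fun a _ =>
            Finset.sum_congr rfl fun b _ => by ring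
  rw [key]
  exact Finset.sum_nonneg fun k _ => hF.dotProduct_mulVec_nonneg _

end Pairing

/-! ### Conjugation of products; signs -/

section Generic

variable {ι : Type*} [Fintype ι] [DecidableEq ι]

/-- Conjugation by `W` (with `W Wᴴ = 1 = Wᴴ W`) is multiplicative on products. [folklore] -/
private theorem conj_list_prod {W : Matrix ι ι ℂ} (hW : W * Wᴴ = 1) (hW' : Wᴴ * W = 1)
    (l : List (Matrix ι ι ℂ)) :
    Wᴴ * l.prod * W = (l.map fun A => Wᴴ * A * W).prod := by
  induction l with
  | nil => simp [hW']
  | cons A l ih =>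
    rw [List.map_cons, List.prod_cons, List.prod_cons, ← ih]
    calc Wᴴ * (A * l.prod) * W = Wᴴ * A * (W * Wᴴ) * l.prod * W := by
          rw [hW]; simp only [Matrix.mul_assoc, Matrix.one_mul]
      _ = Wᴴ * A * W * (Wᴴ * l.prod * W) := by simp only [Matrix.mul_assoc]

/-- Conjugation of a product of two. [folklore] -/
private theorem conj_mul {W : Matrix ι ι ℂ} (hW : W * Wᴴ = 1) (A B : Matrix ι ι ℂ) :
    Wᴴ * (A * B) * W = Wᴴ * A * W * (Wᴴ * B * W) := by
  calc Wᴴ * (A * B) * W = Wᴴ * A * (W * Wᴴ) * B * W := by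
        rw [hW]; simp only [Matrix.mul_assoc, Matrix.one_mul]
    _ = Wᴴ * A * W * (Wᴴ * B * W) := by simp only [Matrix.mul_assoc]

/-- Products of scalar multiples. [folklore] -/
private theorem prod_map_smul {α : Type*} (c : α → ℂ) (B : α → Matrix ι ι ℂ) (l : List α) :
    (l.map fun i => c i • B i).prod = (l.map c).prod • (l.map B).prod := by
  induction l with
  | nil => simp
  | cons i l ih => rw [List.map_cons, List.prod_cons, ih, List.map_cons, List.map_cons,
      List.prod_cons, List.prod_cons, smul_mul_smul_comm]

/-- `Π (−1)^{Nᵢ} = (−1)^{Σ Nᵢ}`. [folklore] -/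
private theorem prod_map_neg_one_pow {α : Type*} (N : α → ℕ) (l : List α) :
    (l.map fun i => (-1 : ℂ) ^ N i).prod = (-1 : ℂ) ^ (l.map N).sum := by
  induction l with
  | nil => simp
  | cons i l ih => rw [List.map_cons, List.prod_cons, ih, List.map_cons, List.sum_cons, pow_add]

/-- `Π (−(−1)^{Nᵢ}) = (−1)^{|l|} (−1)^{Σ Nᵢ}`. [folklore] -/
private theorem prod_map_neg_neg_one_pow {α : Type*} (N : α → ℕ) (l : List α) :
    (l.map fun i => -(-1 : ℂ) ^ N i).prod = (-1 : ℂ) ^ l.length * (-1 : ℂ) ^ (l.map N).sum := by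
  induction l with
  | nil => simp
  | cons i l ih =>
    rw [List.map_cons, List.prod_cons, ih, List.map_cons, List.sum_cons, List.length_cons,
      pow_succ, pow_add]
    ring

/-- A product of real matrices is real. [folklore] -/
private theorem transpose_list_prod_eq_conjTranspose (l : List (Matrix ι ι ℂ))
    (h : ∀ A ∈ l, Aᵀ = Aᴴ) : (l.prod)ᵀ = (l.prod)ᴴ := by
  induction l with
  | nil => simp
  | cons A l ih =>
    rw [List.prod_cons, transpose_mul, conjTranspose_mul, h A (by simp),
      ih fun B hB => h B (by simp [hB])]

omit [Fintype ι] [DecidableEq ι] in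
/-- A real matrix is fixed by entrywise conjugation. [folklore] -/
private theorem map_star_eq_self_of_transpose_eq {X : Matrix ι ι ℂ} (h : Xᵀ = Xᴴ) : X.map star = X := by
  ext i j
  have hij := congrFun (congrFun h j) i
  rw [transpose_apply, conjTranspose_apply] at hij
  rw [Matrix.map_apply]
  exact hij.symm

/-- `(−1)^N · (−1)^N = 1`. [folklore] -/
private theorem neg_one_pow_mul_self (N : ℕ) : (-1 : ℂ) ^ N * (-1 : ℂ) ^ N = 1 := by
  rw [← pow_add, ← two_mul, pow_mul, neg_one_sq, one_pow]

/-- `(−1)^N` is real. [folklore] -/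
private theorem star_neg_one_pow (N : ℕ) : star ((-1 : ℂ) ^ N) = (-1 : ℂ) ^ N := by
  rw [star_pow, star_neg, star_one]

end Generic

/-! ### Sublattice parity on the even torus -/

section Torus

variable {d : ℕ} (k : ℕ) [NeZero (2 * k)] (j : Fin d) (a : ZMod (2 * k)) (n : ℕ)

/-- The sublattice parity `Σᵢ xᵢ mod 2` of a site of the even torus. [folklore] -/
private def parity (x : TorusSite d (2 * k)) : ZMod 2 :=
  ∑ i, ZMod.castHom (dvd_mul_right 2 k) (ZMod 2) (x i)

/-- The staggered sign `(−1)^{Σᵢ xᵢ}` (canonical representatives). [folklore] -/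
private def stag (x : TorusSite d (2 * k)) : ℂ := (-1 : ℂ) ^ (∑ i, (x i).val)

/-- The staggered sign in terms of the parity. [folklore] -/
private theorem stag_eq_ite (x : TorusSite d (2 * k)) : stag k x = if parity k x = 0 then 1 else -1 :=
  neg_one_pow_sum_val_eq k x

omit [NeZero (2 * k)] in
/-- The reflection between sites flips the sublattice parity (even side). [folklore] -/
private theorem parity_reflect (x : TorusSite d (2 * k)) :
    parity k (Torus.reflectBetweenSites j a x) = parity k x + 1 := by
  unfold parity
  rw [Torus.reflectBetweenSites_apply]
  have hupd : (fun i => ZMod.castHom (dvd_mul_right 2 k) (ZMod 2)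
      (Function.update x j (2 * a + 1 - x j) i)) =
      Function.update (fun i => ZMod.castHom (dvd_mul_right 2 k) (ZMod 2) (x i)) j
        (ZMod.castHom (dvd_mul_right 2 k) (ZMod 2) (2 * a + 1 - x j)) := by
    ext i
    by_cases hi : i = j
    · subst hi; simp
    · simp [hi]
  rw [hupd, Finset.sum_update_of_mem (Finset.mem_univ j),
    ← Finset.add_sum_erase _ _ (Finset.mem_univ j), Finset.sdiff_singleton_eq_erase]
  have h2 : (ZMod.castHom (dvd_mul_right 2 k) (ZMod 2)) (2 * a + 1 - x j) =
      ZMod.castHom (dvd_mul_right 2 k) (ZMod 2) (x j) + 1 := by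
    rw [map_sub, map_add, map_mul, map_one, map_ofNat]
    have h20 : (2 : ZMod 2) = 0 := by decide
    rw [h20, zero_mul, zero_add, sub_eq_add_neg, ZMod.neg_eq_self_mod_two, add_comm]
  rw [h2]
  ring

/-- `x` and `θx` carry opposite staggered signs. [folklore] -/
private theorem stag_reflect (x : TorusSite d (2 * k)) :
    stag k (Torus.reflectBetweenSites j a x) = -stag k x := by
  have h01 : ∀ s : ZMod 2, s = 0 ∨ s = 1 := by decide
  have h11 : (1 : ZMod 2) + 1 = 0 := by decide
  rw [stag_eq_ite, stag_eq_ite, parity_reflect]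
  rcases h01 (parity k x) with h | h <;> rw [h] <;> simp [h11]

end Torus

section TorusLetters

variable {d : ℕ} {k : ℕ} [NeZero (2 * k)] (j : Fin d) (a : ZMod (2 * k)) {n : ℕ}

/-! ### The letter rule of the sublattice rotation -/


/-- From `W S Wᴴ = t S` with `t² = 1` to `Wᴴ S W = t S`. [folklore] -/
private theorem conj_inv_of_conj {W S : Op (TorusSite d (2 * k)) (n + 1)} (hW' : Wᴴ * W = 1) {t : ℂ}
    (ht : t * t = 1) (h : W * S * Wᴴ = t • S) : Wᴴ * S * W = t • S := by
  have h1 : Wᴴ * (W * S * Wᴴ) * W = S := by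
    calc Wᴴ * (W * S * Wᴴ) * W = (Wᴴ * W) * S * (Wᴴ * W) := by simp only [Matrix.mul_assoc]
      _ = S := by rw [hW', Matrix.one_mul, Matrix.mul_one]
  rw [h, Matrix.mul_smul, Matrix.smul_mul] at h1
  calc Wᴴ * S * W = (t * t) • (Wᴴ * S * W) := by rw [ht, one_smul]
    _ = t • S := by rw [← smul_smul, h1]

/-- `S⁺ = S¹ + iS²` placed at a site. [folklore] -/
private theorem onSite_spinRaise {Λ : Type*} [Fintype Λ] [DecidableEq Λ] (n : ℕ) (y : Λ) :
    (onSite y (spinRaise n) : Op Λ (n + 1)) = siteSpin n y 0 + Complex.I • siteSpin n y 1 := by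
  rw [siteSpin, siteSpin, spinVec_zero, spinVec_one, ← onSite_smul', ← onSite_add', I_smul_spinY,
    spinX]
  congr 1
  module

/-- `S⁻ = S¹ − iS²` placed at a site. [folklore] -/
private theorem onSite_spinLower {Λ : Type*} [Fintype Λ] [DecidableEq Λ] (n : ℕ) (y : Λ) :
    (onSite y (spinLower n) : Op Λ (n + 1)) = siteSpin n y 0 - Complex.I • siteSpin n y 1 := by
  rw [siteSpin, siteSpin, spinVec_zero, spinVec_one, ← onSite_smul', ← onSite_sub', I_smul_spinY,
    spinX]
  congr 1
  module

/-- **The letter rule of the sublattice rotation**: `Wᴴ S^ℓ_y W = ε_y · S^{twist ℓ}_y`, i.e.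
`S^± ↦ S^±`, `Sᶻ ↦ Sᶻ` on the even sublattice and `S^± ↦ −S^∓`, `Sᶻ ↦ −Sᶻ` on the odd one. [folklore] -/
private theorem conj_onSite_letter {W : Op (TorusSite d (2 * k)) (n + 1)} (hW' : Wᴴ * W = 1)
    (hx : ∀ x : TorusSite d (2 * k), W * siteSpin n x 0 * Wᴴ = stag k x • siteSpin n x 0)
    (hy : ∀ x : TorusSite d (2 * k), W * siteSpin n x 1 * Wᴴ = siteSpin n x 1)
    (hz : ∀ x : TorusSite d (2 * k), W * siteSpin n x 2 * Wᴴ = stag k x • siteSpin n x 2)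
    (y : TorusSite d (2 * k)) (l : SpinLetter) :
    Wᴴ * onSite y (l.mat n) * W = stag k y • onSite y ((SpinLetter.twist (parity k y) l).mat n) := by
  have hss : stag k y * stag k y = 1 := neg_one_pow_mul_self _
  have hx' := conj_inv_of_conj hW' hss (hx y)
  have hy' : Wᴴ * siteSpin n y 1 * W = siteSpin n y 1 := by
    have := conj_inv_of_conj hW' (one_mul (1 : ℂ)) (t := 1) (S := siteSpin n y 1)
      (by rw [one_smul]; exact hy y)
    rwa [one_smul] at this
  have hz' := conj_inv_of_conj hW' hss (hz y)
  have h01 : ∀ s : ZMod 2, s = 0 ∨ s = 1 := by decide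
  have hε := stag_eq_ite k y
  rcases h01 (parity k y) with hp | hp
  · -- even site: `ε = 1`, `twist = id`
    rw [hp, if_pos rfl] at hε
    have htw : ∀ l', SpinLetter.twist (parity k y) l' = l' := fun l' => by
      simp [SpinLetter.twist, hp]
    rw [htw, hε, one_smul]
    rw [hε, one_smul] at hx' hz'
    cases l
    · simp only [SpinLetter.mat, onSite_spinRaise, Matrix.mul_add, Matrix.add_mul, Matrix.mul_smul,
        Matrix.smul_mul, hx', hy']
    · simp only [SpinLetter.mat, onSite_spinLower, Matrix.mul_sub, Matrix.sub_mul, Matrix.mul_smul,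
        Matrix.smul_mul, hx', hy']
    · simp only [SpinLetter.mat]
      rw [show (onSite y (SpinOperators.spinZ n) : Op (TorusSite d (2 * k)) (n + 1)) =
        siteSpin n y 2 from by rw [siteSpin, spinVec_two], hz']
  · -- odd site: `ε = −1`, `twist = bar`
    rw [hp, if_neg (by decide)] at hε
    have htw : ∀ l', SpinLetter.twist (parity k y) l' = l'.bar := fun l' => by
      simp [SpinLetter.twist, hp]
    rw [htw, hε]
    rw [hε] at hx' hz'
    cases l
    · simp only [SpinLetter.mat, SpinLetter.bar, onSite_spinRaise, onSite_spinLower, Matrix.mul_add,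
        Matrix.add_mul, Matrix.mul_smul, Matrix.smul_mul, hx', hy', smul_sub, neg_smul, one_smul]
      abel
    · simp only [SpinLetter.mat, SpinLetter.bar, onSite_spinRaise, onSite_spinLower, Matrix.mul_sub,
        Matrix.sub_mul, Matrix.mul_smul, Matrix.smul_mul, hx', hy', smul_add, neg_smul, one_smul]
      abel
    · simp only [SpinLetter.mat, SpinLetter.bar]
      rw [show (onSite y (SpinOperators.spinZ n) : Op (TorusSite d (2 * k)) (n + 1)) =
        siteSpin n y 2 from by rw [siteSpin, spinVec_two], hz']

/-! ### Words in the rotated frame and their pull-backs -/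

variable (k n)

/-- The `W`-frame word on the left half: letters twisted by the parity of their sites. [folklore] -/
private def leftWordK (_hL : Even (2 * k)) (w : List (torusLeftHalf (2 * k) j a × SpinLetter)) :
    Op (torusLeftHalf (2 * k) j a) (n + 1) :=
  (w.map fun q => onSite q.1
    ((SpinLetter.twist (parity k (q.1 : TorusSite d (2 * k))) q.2).mat n)).prod

/-- The number `Σ_letters Σᵢ (xᵢ)` whose parity is the number of odd sites in the word. [folklore] -/
private def wordDeg (w : List (torusLeftHalf (2 * k) j a × SpinLetter)) : ℕ :=
  (w.map fun q => ∑ i, ((q.1 : TorusSite d (2 * k)) i).val).sum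

variable {k j a n}

/-- `W`-frame words are real. [folklore] -/
private theorem leftWordK_map_star (hL : Even (2 * k)) (w : List (torusLeftHalf (2 * k) j a × SpinLetter)) :
    (leftWordK k j a n hL w).map star = leftWordK k j a n hL w := by
  refine map_star_eq_self_of_transpose_eq (transpose_list_prod_eq_conjTranspose _ fun A hA => ?_)
  obtain ⟨q, -, rfl⟩ := List.mem_map.1 hA
  exact transpose_eq_conjTranspose_onSite _ (SpinLetter.mat_transpose_eq n _)

/-- The left embedding of a `W`-frame word is the product of its letters at the sites `x`. [folklore] -/
private theorem torusLeftEmbed_leftWordK (hL : Even (2 * k))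
    (w : List (torusLeftHalf (2 * k) j a × SpinLetter)) :
    torusLeftEmbed (2 * k) j a hL (leftWordK k j a n hL w) =
      (w.map fun q => (onSite (q.1 : TorusSite d (2 * k))
        ((SpinLetter.twist (parity k (q.1 : TorusSite d (2 * k))) q.2).mat n) :
          Op (TorusSite d (2 * k)) (n + 1))).prod := by
  rw [leftWordK, map_list_prod, List.map_map]
  congr 1
  refine List.map_congr_left fun q _ => ?_
  simp only [Function.comp_apply]
  rw [onSite_eq_submatrix_kronecker_of_mem (2 * k) j a hL q.1.2, torusToLeft_of_mem (2 * k) j a hL q.1.2]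
  rfl

/-- The right embedding of a `W`-frame word is the product of its letters at the sites `θx`. [folklore] -/
private theorem torusRightEmbed_leftWordK (hL : Even (2 * k))
    (w : List (torusLeftHalf (2 * k) j a × SpinLetter)) :
    torusRightEmbed (2 * k) j a hL (leftWordK k j a n hL w) =
      (w.map fun q => (onSite (Torus.reflectBetweenSites j a (q.1 : TorusSite d (2 * k)))
        ((SpinLetter.twist (parity k (q.1 : TorusSite d (2 * k))) q.2).mat n) :
          Op (TorusSite d (2 * k)) (n + 1))).prod := by
  rw [leftWordK, map_list_prod, List.map_map]
  congr 1
  refine List.map_congr_left fun q _ => ?_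
  simp only [Function.comp_apply]
  rw [onSite_reflect_eq_submatrix_kronecker_of_mem (2 * k) j a hL q.1.2,
    torusToLeft_of_mem (2 * k) j a hL q.1.2]
  rfl

/-- Pull-back of the left word: `Wᴴ ι_L(X_w) W = (−1)^{deg w} · m_w`. [folklore] -/
private theorem conj_torusLeftEmbed_leftWordK {W : Op (TorusSite d (2 * k)) (n + 1)} (hW : W * Wᴴ = 1)
    (hW' : Wᴴ * W = 1)
    (hx : ∀ x : TorusSite d (2 * k), W * siteSpin n x 0 * Wᴴ = stag k x • siteSpin n x 0)
    (hy : ∀ x : TorusSite d (2 * k), W * siteSpin n x 1 * Wᴴ = siteSpin n x 1)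
    (hz : ∀ x : TorusSite d (2 * k), W * siteSpin n x 2 * Wᴴ = stag k x • siteSpin n x 2)
    (hL : Even (2 * k)) (w : List (torusLeftHalf (2 * k) j a × SpinLetter)) :
    Wᴴ * torusLeftEmbed (2 * k) j a hL (leftWordK k j a n hL w) * W =
      (-1 : ℂ) ^ wordDeg k j a w • rpWord (2 * k) j a n w := by
  rw [torusLeftEmbed_leftWordK, conj_list_prod hW hW', List.map_map, rpWord, wordDeg,
    ← prod_map_neg_one_pow, ← prod_map_smul]
  congr 1
  refine List.map_congr_left fun q _ => ?_
  simp only [Function.comp_apply]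
  rw [conj_onSite_letter hW' hx hy hz, SpinLetter.twist_twist]
  rfl

/-- Pull-back of the reflected word: `Wᴴ ι_R(X_w) W = (−1)^{|w|} (−1)^{deg w} · Θ̄m_w`. [folklore] -/
private theorem conj_torusRightEmbed_leftWordK {W : Op (TorusSite d (2 * k)) (n + 1)} (hW : W * Wᴴ = 1)
    (hW' : Wᴴ * W = 1)
    (hx : ∀ x : TorusSite d (2 * k), W * siteSpin n x 0 * Wᴴ = stag k x • siteSpin n x 0)
    (hy : ∀ x : TorusSite d (2 * k), W * siteSpin n x 1 * Wᴴ = siteSpin n x 1)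
    (hz : ∀ x : TorusSite d (2 * k), W * siteSpin n x 2 * Wᴴ = stag k x • siteSpin n x 2)
    (hL : Even (2 * k)) (w : List (torusLeftHalf (2 * k) j a × SpinLetter)) :
    Wᴴ * torusRightEmbed (2 * k) j a hL (leftWordK k j a n hL w) * W =
      ((-1 : ℂ) ^ w.length * (-1 : ℂ) ^ wordDeg k j a w) • rpReflWord (2 * k) j a n w := by
  rw [torusRightEmbed_leftWordK, conj_list_prod hW hW', List.map_map, rpReflWord, wordDeg,
    ← prod_map_neg_neg_one_pow, ← prod_map_smul]
  congr 1
  refine List.map_congr_left fun q _ => ?_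
  simp only [Function.comp_apply]
  rw [conj_onSite_letter hW' hx hy hz, parity_reflect, SpinLetter.twist_add_one_twist, stag_reflect]
  rfl

end TorusLetters

end GroundStateRP

/-! ### The theorem -/

section Heisenberg

open GroundStateRP

variable {d : ℕ}

/-- **The Heisenberg antiferromagnet on the even torus has a unique ground state** (`(ℤ/Lℤ)^d`,
`2 ∣ L`, `d ≥ 1`, `J > 0`, any spin `n/2`): Lieb–Mattis `2S₀ + 1 = 1` on the connected bipartite
balanced torus (`LiebMattis.hasUniqueGroundState_of_card_compl_eq`, bipartition
`TorusBipartite.evenSublattice`).  The summit cell's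
`Summit.HubbardSuperconductivity.HubbardLadder.heisenbergTorus_hasUniqueGroundState_of_even` is
the same statement (not importable here). [cite: LiebMattis1962, Theorem 2] -/
theorem heisenbergTorus_hasUniqueGroundState_of_two_dvd (i : Fin d) (L : ℕ) [NeZero L]
    (hL : 2 ∣ L) (n : ℕ) {J : ℝ} (hJ : 0 < J) : (heisenbergTorus d L n J).HasUniqueGroundState :=
  LiebMattis.hasUniqueGroundState_of_card_compl_eq n (torusGraph d L) (evenSublattice (d := d) L hL)
    J (torusGraph_connected_of_proj d L) (torusGraph_isBipartiteWith_evenSublattice L hL) hJ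
    (card_compl_evenSublattice L hL i)

/-- **Ground-state reflection positivity of the Heisenberg antiferromagnet, word form.**  For the
antiferromagnet `H = J Σ 𝐒_x·𝐒_y`, `J > 0`, on the even torus `(ℤ/Lℤ)^d`, every unit ground-state
vector `ψ`, every plane pair `(j, a)` and every finite family of words `m_a` in the letters
`S⁺, S⁻, Sᶻ` at sites of the left half, the matrix `[(−1)^{|m_b|} ⟨ψ, m_a Θ̄m_b ψ⟩]_{ab}` is
positive semidefinite.  [cite: DLS1978, Theorem 4.2] [cite: KLS1988JSP, eqs. (15)–(25)] -/
theorem heisenbergTorus_rpGram_posSemidef (L : ℕ) [NeZero L] (hL : Even L) (j : Fin d) (a : ZMod L) (n : ℕ)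
    {J : ℝ} (hJ : 0 < J) {ψ : TensorIndex (TorusSite d L) (n + 1) → ℂ}
    (hψ : ψ ∈ (heisenbergTorus d L n J).groundSpace) (hψ1 : star ψ ⬝ᵥ ψ = 1)
    {κ : Type*} [Fintype κ] (w : κ → List (torusLeftHalf L j a × SpinLetter)) :
    (Matrix.of fun a' b : κ => (-1 : ℂ) ^ (w b).length *
      (star ψ ⬝ᵥ ((rpWord L j a n (w a') * rpReflWord L j a n (w b)) *ᵥ ψ))).PosSemidef := by
  classical
  obtain ⟨k, hk⟩ := hL
  rw [← two_mul] at hk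
  subst hk
  have hL : Even (2 * k) := even_two_mul k
  -- the sublattice rotation
  obtain ⟨W, hW, hW', hWH, hx, hy, hz⟩ := exists_sublatticeRotation (d := d) k n
  -- the Kronecker form of the rotated Hamiltonian
  set e := torusSplit (q := n + 1) (2 * k) j a hL with he
  set A₀ : Op (torusLeftHalf (2 * k) j a) (n + 1) :=
    xyLeftHamiltonian (2 * k) j a hL n 0 - torusZZLeft (2 * k) j a hL n with hA₀
  set M₀ : torusCrossSites (2 * k) j a × Bool ⊕ torusCrossSites (2 * k) j a →
      Op (torusLeftHalf (2 * k) j a) (n + 1) :=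
    Sum.elim (xyCrossOp (2 * k) j a hL n 0) (torusZZCrossOp (2 * k) j a hL n) with hM₀
  set K : Matrix _ _ ℂ := A₀ ⊗ₖ (1 : Op (torusLeftHalf (2 * k) j a) (n + 1)) +
      (1 : Op (torusLeftHalf (2 * k) j a) (n + 1)) ⊗ₖ A₀ - ∑ i, M₀ i ⊗ₖ M₀ i with hKdef
  have hdls : dlsHamiltonian d (2 * k) n = K.submatrix e e := by
    rw [dlsHamiltonian_eq_dlsField_zero, dlsField_eq_submatrix (2 * k) j a hL n 0]
    rfl
  have hKh : K.IsHermitian := by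
    have hKe : K = (dlsHamiltonian d (2 * k) n).submatrix e.symm e.symm := by
      rw [hdls, submatrix_submatrix, Equiv.self_comp_symm, submatrix_id_id]
    rw [hKe]
    exact (dlsHamiltonian_isHermitian d (2 * k) n).submatrix _
  have hAt : A₀ᵀ = A₀ := by
    rw [dlsLeft_transpose_eq (2 * k) j a hL n 0]
    exact ((xyLeftHamiltonian_isHermitian (2 * k) j a n hL 0).sub
      (torusZZLeft_isHermitian (2 * k) j a hL n)).eq
  have hMt : ∀ i, (M₀ i)ᵀ = (M₀ i)ᴴ := dlsCrossOp_transpose_eq (2 * k) j a hL n 0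
  -- the conjugation identity `W H Wᴴ = J · K|_e`
  have hconj : W * heisenbergTorus d (2 * k) n J * Wᴴ = (J : ℂ) • K.submatrix e e := by
    rw [hWH J, hdls]
  have hHu : (heisenbergTorus d (2 * k) n J).HasUniqueGroundState :=
    heisenbergTorus_hasUniqueGroundState_of_two_dvd j (2 * k) (dvd_mul_right 2 k) n hJ
  have hKu : K.HasUniqueGroundState := hasUniqueGroundState_of_conj_submatrix hKh hW hW' hJ hconj hHu
  -- the transported ground state
  set φ : (torusLeftHalf (2 * k) j a → Fin (n + 1)) × (torusLeftHalf (2 * k) j a → Fin (n + 1)) → ℂ :=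
    (W *ᵥ ψ) ∘ e.symm with hφ
  have hφmem : φ ∈ K.groundSpace :=
    (mem_groundSpace_iff_of_conj_submatrix hKh hW hW' hJ hconj ψ).1 hψ
  have hφ1 : star φ ⬝ᵥ φ = 1 := by
    rw [hφ, star_comp_dotProduct_comp_equiv, star_mulVec_dotProduct_mulVec_self hW', hψ1]
  -- reflection positivity in the `W`-frame
  have hRP := Matrix.groundState_reflectionPositive A₀ M₀ hAt hMt hKh hKu hφmem hφ1
    (fun b => leftWordK k j a n hL (w b))
  -- the `W`-frame Gram matrix, pulled back
  set σ : κ → ℂ := fun b => (-1 : ℂ) ^ wordDeg k j a (w b) with hσ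
  set F : Matrix κ κ ℂ := Matrix.of fun i i' : κ => (-1 : ℂ) ^ (w i).length *
      (star ψ ⬝ᵥ ((rpWord (2 * k) j a n (w i') * rpReflWord (2 * k) j a n (w i)) *ᵥ ψ)) with hF
  have hentry : ∀ i i' : κ,
      star φ ⬝ᵥ ((leftWordK k j a n hL (w i') ⊗ₖ (leftWordK k j a n hL (w i)).map star) *ᵥ φ) =
        σ i' * σ i * F i i' := by
    intro i i'
    rw [leftWordK_map_star, hφ, star_comp_dotProduct_mulVec_comp,
      ← torusLeftEmbed_mul_torusRightEmbed, Matrix.star_mulVec_dotProduct_mulVec, conj_mul hW,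
      conj_torusLeftEmbed_leftWordK hW hW' hx hy hz, conj_torusRightEmbed_leftWordK hW hW' hx hy hz,
      smul_mul_smul_comm, smul_mulVec, dotProduct_smul, smul_eq_mul]
    simp only [hσ, hF, Matrix.of_apply]
    ring
  have hG : (Matrix.of fun i i' : κ => σ i' * σ i * F i i').PosSemidef := by
    have : (Matrix.of fun i i' : κ => star φ ⬝ᵥ
        ((leftWordK k j a n hL (w i') ⊗ₖ (leftWordK k j a n hL (w i)).map star) *ᵥ φ)) =
        Matrix.of fun i i' : κ => σ i' * σ i * F i i' := by
      ext i i'; simp only [Matrix.of_apply, hentry]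
    rw [← this]; exact hRP
  -- undo the signs: `F = Dᴴ (D F D) D` with `D = diag σ`, `σ² = 1`, `σ̄ = σ`
  have hσσ : ∀ i, σ i * σ i = 1 := fun i => neg_one_pow_mul_self _
  have hσs : ∀ i, star (σ i) = σ i := fun i => star_neg_one_pow _
  have hFeq : F = (diagonal σ)ᴴ * (Matrix.of fun i i' : κ => σ i' * σ i * F i i') * diagonal σ := by
    ext i i'
    rw [mul_diagonal, diagonal_conjTranspose, diagonal_mul, Matrix.of_apply, Pi.star_apply, hσs]
    calc F i i' = (σ i * σ i) * (σ i' * σ i') * F i i' := by rw [hσσ, hσσ, one_mul, one_mul]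
      _ = σ i * (σ i' * σ i * F i i') * σ i' := by ring
  have hFpsd : F.PosSemidef := by rw [hFeq]; exact hG.conjTranspose_mul_mul_same _
  -- the stated matrix is `Fᵀ`
  have hT : (Matrix.of fun a' b : κ => (-1 : ℂ) ^ (w b).length *
      (star ψ ⬝ᵥ ((rpWord (2 * k) j a n (w a') * rpReflWord (2 * k) j a n (w b)) *ᵥ ψ))) = Fᵀ := by
    ext a' b; rfl
  rw [hT]
  exact hFpsd.transpose

/-- **Ground-state reflection positivity, ground-state functional form**: for the (unique, Lieb–Mattis) ground state
`ω` of the even-torus antiferromagnet, `[(−1)^{|m_b|} ω(m_a Θ̄m_b)]_{ab} ⪰ 0`.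
[cite: DLS1978, Theorem 4.2] [cite: KLS1988JSP, eqs. (15)–(25)] [cite: LiebMattis1962, Theorem 2] -/
theorem heisenbergTorus_groundStateFunctional_rpGram_posSemidef (L : ℕ) [NeZero L] (hL : Even L) (j : Fin d)
    (a : ZMod L) (n : ℕ) {J : ℝ} (hJ : 0 < J)
    {κ : Type*} [Fintype κ] (w : κ → List (torusLeftHalf L j a × SpinLetter)) :
    (Matrix.of fun a' b : κ => (-1 : ℂ) ^ (w b).length *
      (heisenbergTorus d L n J).groundStateFunctional
        (rpWord L j a n (w a') * rpReflWord L j a n (w b))).PosSemidef := by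
  have hH : (heisenbergTorus d L n J).IsHermitian := heisenbergHamiltonian_isHermitian n _ J
  have hL2 : 2 ∣ L := by obtain ⟨r, hr⟩ := hL; exact ⟨r, by omega⟩
  have hHu : (heisenbergTorus d L n J).HasUniqueGroundState :=
    heisenbergTorus_hasUniqueGroundState_of_two_dvd j L hL2 n hJ
  obtain ⟨ψ, hψ1, hψE⟩ := Matrix.exists_groundState_unit hH
  have hψ : ψ ∈ (heisenbergTorus d L n J).groundSpace :=
    (Matrix.rayleigh_eq_groundEnergy_iff_holds hH ψ hψ1).1 hψE
  have hψ0 : ψ ≠ 0 := fun h => by rw [h, dotProduct_zero] at hψ1; exact zero_ne_one hψ1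
  have hω : ∀ O, (heisenbergTorus d L n J).groundStateFunctional O = star ψ ⬝ᵥ (O *ᵥ ψ) := fun O => by
    rw [groundStateFunctional_eq_of_hasUniqueGroundState hHu hψ hψ0, hψ1, div_one]
  simp only [hω]
  exact heisenbergTorus_rpGram_posSemidef L hL j a n hJ hψ hψ1 w

end Heisenberg

/-! ### Certificate rows -/

section Rows

open GroundStateRP

variable {d : ℕ}

/-- **The reflection-positivity block is nonnegative in the ground state**: for `G ⪰ 0`,
`ω(Σ_ab G_ab (−1)^{|m_b|} m_a Θ̄m_b) = Σ_ab G_ab R_ab ≥ 0` (`R ⪰ 0` by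
`heisenbergTorus_groundStateFunctional_rpGram_posSemidef`). [cite: DLS1978, Theorem 4.2] -/
theorem heisenbergTorus_groundStateFunctional_rpForm_nonneg (L : ℕ) [NeZero L] (hL : Even L) (j : Fin d)
    (a : ZMod L) (n : ℕ) {J : ℝ} (hJ : 0 < J) {κ : Type*} [Fintype κ] [DecidableEq κ]
    {G : Matrix κ κ ℂ} (hG : G.PosSemidef) (w : κ → List (torusLeftHalf L j a × SpinLetter)) :
    0 ≤ (heisenbergTorus d L n J).groundStateFunctional (rpForm L j a n G w) := by
  rw [rpForm, map_sum]
  simp only [map_sum, map_smul, smul_eq_mul]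
  have h := sum_sum_mul_nonneg_of_posSemidef hG
    (heisenbergTorus_groundStateFunctional_rpGram_posSemidef L hL j a n hJ w)
  simpa only [Matrix.of_apply] using h

/-- **Energy row with a reflection-positivity block** (the `rp` block of a ground-state
bootstrap certificate): an identity `H − c·1 = Σ Λᵢⱼ Oᵢᴴ Oⱼ + Σₖ (H Xₖ − Xₖ H) + Σₗ (Uₗ Yₗ Uₗᴴ − Yₗ) + rpForm G m`
with `Λ ⪰ 0`, unitaries `Uₗ` commuting with `H`, and `G ⪰ 0` certifies `c ≤ E₀(H)` for the
antiferromagnet on the even torus.  [cite: DLS1978, Theorem 4.2] [cite: Han2020Bootstrap, §2 eq. (3)] -/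
theorem heisenbergTorus_groundEnergy_ge_of_certificate_rp (L : ℕ) [NeZero L] (hL : Even L)
    (j : Fin d) (a : ZMod L) (n : ℕ) {J : ℝ} (hJ : 0 < J)
    {m' : Type*} [Fintype m'] [DecidableEq m'] {Λ : Matrix m' m' ℂ} (hΛ : Λ.PosSemidef)
    (O : m' → Op (TorusSite d L) (n + 1))
    {ι₁ : Type*} (s : Finset ι₁) (X : ι₁ → Op (TorusSite d L) (n + 1))
    {ι₂ : Type*} (t : Finset ι₂) (U Y : ι₂ → Op (TorusSite d L) (n + 1))
    (hU : ∀ l ∈ t, U l * heisenbergTorus d L n J = heisenbergTorus d L n J * U l)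
    (hUU : ∀ l ∈ t, (U l)ᴴ * U l = 1)
    {κ : Type*} [Fintype κ] [DecidableEq κ] {G : Matrix κ κ ℂ} (hG : G.PosSemidef)
    (w : κ → List (torusLeftHalf L j a × SpinLetter)) {c : ℝ}
    (hcert : heisenbergTorus d L n J - (c : ℂ) • (1 : Op (TorusSite d L) (n + 1)) =
      gramForm Λ O +
        (∑ b ∈ s, (heisenbergTorus d L n J * X b - X b * heisenbergTorus d L n J) +
          ∑ l ∈ t, (U l * Y l * (U l)ᴴ - Y l)) +
        rpForm L j a n G w) :
    c ≤ (heisenbergTorus d L n J).groundEnergy := by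
  set A := heisenbergTorus d L n J with hA
  have hAh : A.IsHermitian := heisenbergHamiltonian_isHermitian n _ J
  set ω := A.groundStateFunctional with hω
  have hpos : ∀ x : Op (TorusSite d L) (n + 1), 0 ≤ ω (star x * x) := fun x => by
    rw [hω, Matrix.star_eq_conjTranspose]; exact Matrix.groundStateFunctional_nonneg A x
  have hone : ω 1 = 1 := Matrix.groundStateFunctional_one hAh
  have hnull : ω (∑ b ∈ s, (A * X b - X b * A) + ∑ l ∈ t, (U l * Y l * (U l)ᴴ - Y l)) = 0 := by
    rw [map_add, map_sum, map_sum]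
    have h1 : ∀ b ∈ s, ω (A * X b - X b * A) = 0 := fun b _ => by
      rw [map_sub, hω, Matrix.groundStateFunctional_hamiltonian_mul hAh,
        Matrix.groundStateFunctional_mul_hamiltonian, sub_self]
    have h2 : ∀ l ∈ t, ω (U l * Y l * (U l)ᴴ - Y l) = 0 := fun l hl => by
      rw [map_sub, hω, Matrix.groundStateFunctional_conj_of_commute hAh (hU l hl) (hUU l hl),
        sub_self]
    rw [Finset.sum_eq_zero h1, Finset.sum_eq_zero h2, add_zero]
  have hr : -(0 : ℝ) ≤ (ω (rpForm L j a n G w)).re := by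
    rw [neg_zero]
    exact (Complex.nonneg_iff.mp (heisenbergTorus_groundStateFunctional_rpForm_nonneg L hL j a n hJ hG w)).1
  have h := le_re_map_of_certificate_residual ω hpos hone hΛ O hnull hr hcert
  rw [sub_zero, hω, Matrix.groundStateFunctional_hamiltonian hAh, Complex.ofReal_re] at h
  exact h

/-- **Energy row with a reflection-positivity block and a residual** (the form a rounded
certificate has): an identity
`H − c·1 = Σ Λᵢⱼ Oᵢᴴ Oⱼ + Σₖ (H Xₖ − Xₖ H) + Σₗ (Uₗ Yₗ Uₗᴴ − Yₗ) + (rpForm G m + r)` with `Λ ⪰ 0`,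
unitaries `Uₗ` commuting with `H`, `G ⪰ 0` and a residual `r` whose ground-state expectation is
bounded below, `−ε ≤ Re ω(r)` (e.g. termwise from `|ω(M)| ≤ ‖M‖`), certifies `c − ε ≤ E₀(H)`.
[cite: DLS1978, Theorem 4.2] [cite: Han2020Bootstrap, §2 eq. (3)] -/
theorem heisenbergTorus_groundEnergy_ge_of_certificate_rp_residual (L : ℕ) [NeZero L] (hL : Even L)
    (j : Fin d) (a : ZMod L) (n : ℕ) {J : ℝ} (hJ : 0 < J)
    {m' : Type*} [Fintype m'] [DecidableEq m'] {Λ : Matrix m' m' ℂ} (hΛ : Λ.PosSemidef)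
    (O : m' → Op (TorusSite d L) (n + 1))
    {ι₁ : Type*} (s : Finset ι₁) (X : ι₁ → Op (TorusSite d L) (n + 1))
    {ι₂ : Type*} (t : Finset ι₂) (U Y : ι₂ → Op (TorusSite d L) (n + 1))
    (hU : ∀ l ∈ t, U l * heisenbergTorus d L n J = heisenbergTorus d L n J * U l)
    (hUU : ∀ l ∈ t, (U l)ᴴ * U l = 1)
    {κ : Type*} [Fintype κ] [DecidableEq κ] {G : Matrix κ κ ℂ} (hG : G.PosSemidef)
    (w : κ → List (torusLeftHalf L j a × SpinLetter))
    {r : Op (TorusSite d L) (n + 1)} {ε : ℝ}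
    (hr : -ε ≤ ((heisenbergTorus d L n J).groundStateFunctional r).re) {c : ℝ}
    (hcert : heisenbergTorus d L n J - (c : ℂ) • (1 : Op (TorusSite d L) (n + 1)) =
      gramForm Λ O +
        (∑ b ∈ s, (heisenbergTorus d L n J * X b - X b * heisenbergTorus d L n J) +
          ∑ l ∈ t, (U l * Y l * (U l)ᴴ - Y l)) +
        (rpForm L j a n G w + r)) :
    c - ε ≤ (heisenbergTorus d L n J).groundEnergy := by
  set A := heisenbergTorus d L n J with hA
  have hAh : A.IsHermitian := heisenbergHamiltonian_isHermitian n _ J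
  set ω := A.groundStateFunctional with hω
  have hpos : ∀ x : Op (TorusSite d L) (n + 1), 0 ≤ ω (star x * x) := fun x => by
    rw [hω, Matrix.star_eq_conjTranspose]; exact Matrix.groundStateFunctional_nonneg A x
  have hone : ω 1 = 1 := Matrix.groundStateFunctional_one hAh
  have hnull : ω (∑ b ∈ s, (A * X b - X b * A) + ∑ l ∈ t, (U l * Y l * (U l)ᴴ - Y l)) = 0 := by
    rw [map_add, map_sum, map_sum]
    have h1 : ∀ b ∈ s, ω (A * X b - X b * A) = 0 := fun b _ => by
      rw [map_sub, hω, Matrix.groundStateFunctional_hamiltonian_mul hAh,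
        Matrix.groundStateFunctional_mul_hamiltonian, sub_self]
    have h2 : ∀ l ∈ t, ω (U l * Y l * (U l)ᴴ - Y l) = 0 := fun l hl => by
      rw [map_sub, hω, Matrix.groundStateFunctional_conj_of_commute hAh (hU l hl) (hUU l hl),
        sub_self]
    rw [Finset.sum_eq_zero h1, Finset.sum_eq_zero h2, add_zero]
  have hrp : 0 ≤ (ω (rpForm L j a n G w)).re :=
    (Complex.nonneg_iff.mp (heisenbergTorus_groundStateFunctional_rpForm_nonneg L hL j a n hJ hG w)).1
  have hr' : -ε ≤ (ω (rpForm L j a n G w + r)).re := by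
    rw [map_add, Complex.add_re]
    have hr0 : -ε ≤ (ω r).re := hr
    linarith
  have h := le_re_map_of_certificate_residual ω hpos hone hΛ O hnull hr' hcert
  rw [hω, Matrix.groundStateFunctional_hamiltonian hAh, Complex.ofReal_re] at h
  exact h

end Rows

end Literature.MathematicalPhysics.QuantumLattice

end
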